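import Summits.HubbardSuperconductivity.HubbardSuperconductivity.Theorems.JosephsonMirrorJmPairBridgeSchurCusp
import Summits.HubbardSuperconductivity.HubbardSuperconductivity.Theorems.JosephsonMirrorJmPairBridgeSpaceGroupFamily
import HarnessLib

/-!
# Crux `JmPairBridge` (stmt-HubbardSuperconductivity-2226), line `Sketch` (Schur landing):
# the space-group form of the Schur glue

Route `JosephsonMirror`, crux `JmPairBridge`. The most concrete statement of what line `Sketch` leaves of the crux:
crux `JmInterchange` (stmt-2227), the uniform linear Josephson gain of `JmCusp (i)` (stmt-2228) at some
`(U, δ, a, J₀)`, and EVENTUAL IRREDUCIBILITY OF THE `(N_L, 0)` GROUND FLOOR of `hubbardTorus 2 L 1 U` UNDER THE SPACE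
GROUP of the torus (`U_γ U_v = fockD4 γ * fockTranslate v`) prove `JmPairBridge` — composition of
`jmPairBridge_of_interchange_of_irreducible` (`…SchurCusp`) with `exists_symmetryFamily_of_spaceGroup_irreducible`
(`…SpaceGroupFamily`). This is the recommended restatement of `JmCusp (ii)` for the tenure planner; simplicity ⇒
irreducibility (`floor_eq_bot_or_eq_of_simple`), so the restated bet is WEAKER, and the route's glue
`JmInterchange → JmCusp → JmPairBridge` is re-derived through it (`jmPairBridge_of_interchange_of_cusp`).

Sources: T. Koma, H. Tasaki, J. Stat. Phys. 76 (1994) 745, §3.4; J.-P. Serre, *Linear Representations of Finite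
Groups* §2.2; D. J. Scalapino, Phys. Rep. 250 (1995) 329, §2. No definition, no named fact.
-/

noncomputable section

-- the mandated namespace `Summit.<Summit>.<Problem>.Theorems` repeats `HubbardSuperconductivity`
-- (single-problem summit, D-0017), which the `dupNamespace` linter flags on every declaration
set_option linter.dupNamespace false

namespace Summit.HubbardSuperconductivity.HubbardSuperconductivity.Theorems.JosephsonMirror

open Matrix Literature.MathematicalPhysics.QuantumLattice Literature.Probability.LatticeModels
open Summit.HubbardSuperconductivity.HubbardSuperconductivity.Theses.JosephsonMirror
  (JmPairBridge JmInterchange JmCusp)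
open scoped ComplexOrder

/-- **The space-group form of the Schur glue** (the most concrete statement of what the line leaves of the
crux): crux `JmInterchange` (stmt-2227), the uniform linear Josephson gain of `JmCusp (i)` at some
`(U, δ, a, J₀)`, and, eventually in even `L`, irreducibility of the `(N_L, 0)` ground floor of
`hubbardTorus 2 L 1 U` under the SPACE GROUP of the torus (`U_γ U_v = fockD4 γ * fockTranslate v`: no
subspace of the floor other than `⊥` and the floor is invariant under all of them) prove the crux
`JmPairBridge`. Koma–Tasaki, J. Stat. Phys. 76 (1994) 745, §3.4; Serre §2.2; Scalapino (1995) §2. [folklore] -/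
theorem jmPairBridge_of_interchange_of_spaceGroupIrreducible (hI : JmInterchange)
    (hC : ∃ U : ℝ, 0 < U ∧ ∃ δ ∈ Set.Ioo (0:ℝ) (1 / 2), ∃ a : ℝ, 0 < a ∧ ∃ J₀ : ℝ, 0 < J₀ ∧
      (∀ J ∈ Set.Ioc (0:ℝ) J₀, ∃ L₀ : ℕ, ∀ (L : ℕ) [NeZero L], Even L → L₀ ≤ L →
        (let ι : Type := Finset (Orb (FermionTorus 2 L))
         let N : ℕ := 2 * ⌊(1 - δ) * (L : ℝ) ^ 2 / 2⌋₊
         let H : Matrix ι ι ℂ := hubbardTorus 2 L 1 U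
         let μ : ℝ := (H.minEnergyOn (szSector N 0) - H.minEnergyOn (szSector (N - 2) 0)) / 2
         let A : Matrix ι ι ℂ := hubbardTorusWith 2 L 1 U μ
         let D : Matrix ι ι ℂ := ((L : ℂ))⁻¹ • pairField dWaveFormFactor L
         let Hd : ℝ → Matrix (ι × ι) (ι × ι) ℂ := fun J =>
           Matrix.kroneckerMap (fun a b : ℂ => a * b) A 1 +
             Matrix.kroneckerMap (fun a b : ℂ => a * b) 1 (Matrix.transpose A) -
             (J : ℂ) • (Matrix.kroneckerMap (fun a b : ℂ => a * b) D
                 (Matrix.transpose (Matrix.conjTranspose D)) +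
               Matrix.kroneckerMap (fun a b : ℂ => a * b) (Matrix.conjTranspose D) (Matrix.transpose D))
         let good : ι × ι → Prop := fun p =>
           ((p.1.card = N ∧ p.2.card = N) ∨ (p.1.card = N - 2 ∧ p.2.card = N - 2)) ∧
             (p.1.filter (fun o => (ofLex o).2 = 0)).card = (p.1.filter (fun o => (ofLex o).2 = 1)).card ∧
             (p.2.filter (fun o => (ofLex o).2 = 0)).card = (p.2.filter (fun o => (ofLex o).2 = 1)).card
         let S : Submodule ℂ (ι × ι → ℂ) :=
           ⨅ (p : ι × ι) (_ : ¬ good p), LinearMap.ker (LinearMap.proj (R := ℂ) (φ := fun _ : ι × ι => ℂ) p)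
         let E : ℝ → ℝ := fun J => (Hd J).minEnergyOn S
         a * J * (L : ℝ) ^ 2 ≤ E 0 - E J)) ∧
      (∃ L₁ : ℕ, ∀ (L : ℕ) [NeZero L], Even L → L₁ ≤ L →
        ∀ K' : Submodule ℂ (Fock (Orb (FermionTorus 2 L))),
          K' ≤ szSector (2 * ⌊(1 - δ) * (L : ℝ) ^ 2 / 2⌋₊) 0 ⊓
              Module.End.eigenspace (Matrix.toLin' (hubbardTorus 2 L 1 U))
                (((hubbardTorus 2 L 1 U).minEnergyOn (szSector (2 * ⌊(1 - δ) * (L : ℝ) ^ 2 / 2⌋₊) 0) : ℝ) : ℂ) →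
          (∀ (γ : DihedralGroup 4) (v : TorusSite 2 L), ∀ w ∈ K',
            ((fockD4 γ).val * (fockTranslate v).val) *ᵥ w ∈ K') →
          K' = ⊥ ∨ K' = szSector (2 * ⌊(1 - δ) * (L : ℝ) ^ 2 / 2⌋₊) 0 ⊓
              Module.End.eigenspace (Matrix.toLin' (hubbardTorus 2 L 1 U))
                (((hubbardTorus 2 L 1 U).minEnergyOn (szSector (2 * ⌊(1 - δ) * (L : ℝ) ^ 2 / 2⌋₊) 0) : ℝ) : ℂ))) :
    JmPairBridge := by
  obtain ⟨U, hU, δ, hδ, a, ha, J₀, hJ₀, hgain, L₁, hirr⟩ := hC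
  refine jmPairBridge_of_interchange_of_irreducible hI ⟨U, hU, δ, hδ, a, ha, J₀, hJ₀, hgain, L₁, ?_⟩
  intro L _ hE hL
  exact exists_symmetryFamily_of_spaceGroup_irreducible U _ _ (hirr L hE hL)

/-- A subspace all of whose non-zero vectors are proportional has no subspaces other than `⊥` and itself.
[folklore] -/
theorem eq_bot_or_eq_of_forall_exists_smul {E : Type*} [AddCommGroup E] [Module ℂ E] (V : Submodule ℂ E)
    (hsimple : ∀ φ ∈ V, ∀ φ' ∈ V, φ ≠ 0 → ∃ c : ℂ, φ' = c • φ) (K' : Submodule ℂ E) (hK' : K' ≤ V) :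
    K' = ⊥ ∨ K' = V := by
  by_cases h : K' = ⊥
  · exact Or.inl h
  · refine Or.inr (le_antisymm hK' fun v hv => ?_)
    obtain ⟨w, hwK', hw0⟩ := (Submodule.ne_bot_iff K').1 h
    obtain ⟨c, rfl⟩ := hsimple w (hK' hwK') v hv hw0
    exact K'.smul_mem c hwK'

/-- A sector ground state of `H` in `(N, S^z = M)` is exactly a non-zero vector of the floor
`szSector N M ⊓ eigenspace H (minEnergyOn H (szSector N M))`. [folklore] -/
theorem isGroundStateInSector_iff_mem_inf_eigenspace {Λ : Type*} [LinearOrder Λ] [Fintype Λ]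
    (H : Matrix (Finset (Orb Λ)) (Finset (Orb Λ)) ℂ) (N : ℕ) (M : ℝ) (ψ : Fock (Orb Λ)) :
    IsGroundStateInSector H N M ψ ↔
      ψ ∈ szSector N M ⊓ Module.End.eigenspace (Matrix.toLin' H) ((H.minEnergyOn (szSector N M) : ℝ) : ℂ) ∧
        ψ ≠ 0 := by
  rw [IsGroundStateInSector, Submodule.mem_inf, Module.End.mem_eigenspace_iff, Matrix.toLin'_apply]
  tauto

/-- **Simplicity ⇒ irreducibility.** If the sector ground floor of `(N, 0)` is simple (any two sector ground
states are proportional — clause (ii) of `JmCusp`), then it has no subspace other than `⊥` and itself, in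
particular none invariant under the space group: the Schur form of `JmCusp (ii)` is WEAKER than `JmCusp (ii)`.
[folklore] -/
theorem floor_eq_bot_or_eq_of_simple {L : ℕ} (U : ℝ) (N : ℕ)
    (hsimple : ∀ φ φ' : Fock (Orb (FermionTorus 2 L)),
      IsGroundStateInSector (hubbardTorus 2 L 1 U) N 0 φ → IsGroundStateInSector (hubbardTorus 2 L 1 U) N 0 φ' →
        ∃ c : ℂ, φ' = c • φ)
    (K' : Submodule ℂ (Fock (Orb (FermionTorus 2 L))))
    (hK' : K' ≤ szSector N 0 ⊓ Module.End.eigenspace (Matrix.toLin' (hubbardTorus 2 L 1 U))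
      (((hubbardTorus 2 L 1 U).minEnergyOn (szSector N 0) : ℝ) : ℂ)) :
    K' = ⊥ ∨ K' = szSector N 0 ⊓ Module.End.eigenspace (Matrix.toLin' (hubbardTorus 2 L 1 U))
      (((hubbardTorus 2 L 1 U).minEnergyOn (szSector N 0) : ℝ) : ℂ) := by
  refine eq_bot_or_eq_of_forall_exists_smul _ (fun φ hφ φ' hφ' hφ0 => ?_) K' hK'
  by_cases hφ'0 : φ' = 0
  · exact ⟨0, by rw [hφ'0, zero_smul]⟩
  · exact hsimple φ φ' ((isGroundStateInSector_iff_mem_inf_eigenspace _ N 0 φ).2 ⟨hφ, hφ0⟩)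
      ((isGroundStateInSector_iff_mem_inf_eigenspace _ N 0 φ').2 ⟨hφ', hφ'0⟩)

/-- **The Schur glue subsumes the route's glue `JmCruxGlue`.** `JmInterchange → JmCusp → JmPairBridge` re-derived
through `jmPairBridge_of_interchange_of_spaceGroupIrreducible`: clause (ii) of `JmCusp` (eventual simplicity of the
`(N_L, 0)` floor) implies eventual space-group irreducibility (`floor_eq_bot_or_eq_of_simple`), so the Schur form
of the bet is weaker than the filed one. (The item `JmCruxGlue`, stmt-14297, is already closed by `jmCruxGlue_proof`;
this is the consistency check of the restatement.) [folklore] -/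
theorem jmPairBridge_of_interchange_of_cusp (hI : JmInterchange) (hC : JmCusp) : JmPairBridge := by
  unfold JmCusp at hC
  obtain ⟨U, hU, δ, hδ, a, ha, J₀, hJ₀, hgain, L₁, hsimple⟩ := hC
  exact jmPairBridge_of_interchange_of_spaceGroupIrreducible hI
    ⟨U, hU, δ, hδ, a, ha, J₀, hJ₀, hgain, L₁, fun L _ hE hL K' hK' _ =>
      floor_eq_bot_or_eq_of_simple U _ (hsimple L hE hL) K' hK'⟩

end Summit.HubbardSuperconductivity.HubbardSuperconductivity.Theorems.JosephsonMirror

end
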